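import Summits.QuantumFields.BalabanUV.T4Continuum.Support.B13TermHistSecantLevels
import Summits.QuantumFields.BalabanUV.T4Continuum.Support.UrsellTermDecay

/-!
# NE5 ∕ U3 — O2-hist WITH THE PRINTED KIND OF RATE: both producers of leaf L04's history half at decay rate `κ > 0`, from a
# factorwise decaying activity majorant (leaf-08's `UrsellTermDecay` mechanism, (2.40)–(2.41) p. 21) — the secant face
# `HistSecant M K W κ (2G₁)` and the Cauchy face `HistFibreEnvelopeCl M W κ G`, and their closures ON THE SOCKET from the displayed
# (2.27) and leaf-08's anchored exponential norm of the STRIPPED majorant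

Cell `pub-balaban`, unit `b2b-balaban-t4-ne5-formalise-leaf-03` (NE5 formalisation swarm, LEAF PROVER 03, gen 2; follower of
`Support/B13TermHistSecant` p210100 ∕ `B13TermHistEnvelope` p210127 ∕ `B13TermHistSecantLevels` p210395, row O2-hist).  Summits-side
bookkeeping under the LEAN PLACEMENT RULE (NOT a Literature module).  HONEST FRAMING: rung (B)+1 of the FINITE-VOLUME T⁴ programme —
NOT infinite volume, NOT a mass gap, NOT the Clay problem, NOT NE5 (NOT PRINTED; GAPS G-t4-U3-1).  HONEST DEPENDENCY (cell line,
verbatim): continuum YM on T⁴ ⇐ BetaPertH ∧ nine spine estimates (0/9 proved); BetaPertH ⇐ (D1) ∧ (D4) ∧ CAP+tail; G-an2-4 gates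
asym, D1 and NE2/3/4.

WHAT THIS FILE DOES.  `B13TermHistSecantLevels.histSecant_socket_of_actNorm` closed the secant face on the socket at decay rate
`κ = 0`.  Leaf-08's `UrsellTermDecay` (p209970) supplies the printed mechanism for the rate ((2.40)–(2.41) p. 21 of
[Balaban1988RG2Cluster]: extract `e^{−κ(d(Z)+c)}` from every factor, bound `Σ_m (d(Z_m)+c)` below by `d(X)` via the displayed (2.27)
`B13FamilySum.Ineq227`, and budget the STRIPPED majorant `A′`): `actMajorant A ≤ e^{−κL}·actMajorant A′` (`actMajorant_le_exp_mul`).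
The secant majorant `secMajorant N A = (Σ_m N_m)·actMajorant A` inherits this on the nose, so:
* §1 (ANY term indexing) `secMajorant_le_exp_mul`, `summable_secMajorant_of_decay`, `tsum_secMajorant_le_of_decay`, and
  **`histSecant_b13_of_act_decay`**: structure + exponent bounds `N ≥ 0` + absolute majorants `A` (at the class points) which DECAY
  FACTORWISE against a stripped `A′ ≥ 0` (`A ≤ A′·e^{−κ s(Z)}`, `κ ≥ 0`) + the geometric binder `d(X) ≤ Σ_m s(poly i m)` on the
  localizing tuples + d3's convergence and the first-moment budget `G₁` FOR `A′` AT RATE 0 ⟹ `HistSecant M K W κ (2G₁)`;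
  likewise **`histFibreEnvelopeCl_b13_of_actBound_decay`** (the Cauchy face: `BoxInClass` + the same + leaf-08's
  `summable_actMajorant_of_decay` ∕ `tsum_actMajorant_le_of_decay` ⟹ `HistFibreEnvelopeCl M W κ G`);
* §2 (THE SOCKET `labelsIndexing G D` ∕ `touchInc G`) **`histSecant_socket_of_actNormDecay`**: with the displayed (2.27)
  `Ineq227 (G.level (scale X)) G.cubes C.d (G.cubes X) (C.d X) c` at every domain (leaf-08's `d_le_sum_polys_of_ineq227` BY NAME),
  a uniform exponent bound `0 ≤ N ≤ N̄` and leaf-08's anchored exponential norm `Φ′` of the stripped majorant (`4νΦ′ < 1`) ⟹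
  `HistSecant M K W κ (2·(N̄·Φ′∕(1 − 4νΦ′)²))`; and **`histFibreEnvelopeCl_socket_of_actNormDecay`** ⟹
  `HistFibreEnvelopeCl M W κ (Φ′∕(1 − 4νΦ′))` (slack `BoxInClass` displayed) — the history-half twins of leaf-08's
  `classBound_b13_of_actNormDecay`.
So, on the socket, BOTH producers of L04-hist at the printed kind of rate are reduced BY NAME to: the structure `ActExpLinearOn` of the
(2.14) terms, per-activity exponent bounds ((2.18)∕(2.20) KIND), absolute activity majorants decaying factorwise with anchored
exponential norm of the stripped majorant ((2.38)+(1.26) KIND), the displayed (2.27), and — for the Cauchy face only — the slack.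
Nothing of the manuscripts under audit is asserted; every input is a displayed SHAPE with a KIND locator.  0 sorry; no new axioms.
-/

noncomputable section

open scoped BigOperators

namespace Summit.QuantumFields.BalabanUV.T4Continuum.B13TermHistSecantDecay

open Literature.MathematicalPhysics.QuantumFieldTheory.Balaban1983to89.T4OutputRate (Carriers)
open Literature.MathematicalPhysics.QuantumFieldTheory.Balaban1983to89.T4InputCauchyRateData (StepModel)
open Literature.MathematicalPhysics.QuantumFieldTheory.Balaban1983to89.T4InputCauchyRateSpecies (BoxInClass)
open Literature.MathematicalPhysics.QuantumFieldTheory.Balaban1983to89.T4InputCauchyRateTermwise (HistFibreEnvelopeCl)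
open Literature.MathematicalPhysics.QuantumFieldTheory.Balaban1983to89.T4InputCauchyRateSecant (HistSecant)
open Literature.MathematicalPhysics.QuantumFieldTheory.Balaban1983to89.B13FamilySum (Ineq227)
open Summit.QuantumFields.BalabanUV.T4Continuum.ClusterRepOfDomains (DomainGeometry)
open Summit.QuantumFields.BalabanUV.T4Continuum.B13StepTermLabels (InnerLabel TermIdx InnerData)
open Summit.QuantumFields.BalabanUV.T4Continuum.B13StepTermFamily (TermIndexing ActData ActExpLinearOn out)
open Summit.QuantumFields.BalabanUV.T4Continuum.B13StepTermSocket (labelsIndexing touchInc)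
open Summit.QuantumFields.BalabanUV.T4Continuum.B13TermRep (actMajorant actMajorant_nonneg)
open Summit.QuantumFields.BalabanUV.T4Continuum.B13ActMajorantLevels (polyWeight)
open Summit.QuantumFields.BalabanUV.T4Continuum.UrsellTreeSum (ind)
open Summit.QuantumFields.BalabanUV.T4Continuum.UrsellTermDecay
  (actMajorant_le_exp_mul summable_actMajorant_of_decay tsum_actMajorant_le_of_decay d_le_sum_polys_of_ineq227)
open Summit.QuantumFields.BalabanUV.T4Continuum.B13TermHistSecant
  (ActExpNormBound ActAbsBound secMajorant secMajorant_nonneg histSecant_b13_of_act)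
open Summit.QuantumFields.BalabanUV.T4Continuum.B13TermHistEnvelope (histFibreEnvelopeCl_b13_of_actBound)
open Summit.QuantumFields.BalabanUV.T4Continuum.B13TermHistSecantLevels
  (summable_secMajorant_of_levelwise tsum_secMajorant_le_of_levelwise summable_levelMajorant_of_moment
    weighted_level_budget_of_actNorm)

/-! ## §1 Decay extraction for the secant majorant, ANY term indexing; both faces at rate `κ` -/

section Generic

variable {C : Carriers} {ι P J : Type*} {𝒯 : TermIndexing C ι P J} {inc : P → P → Prop} [DecidableRel inc]

/-- [folklore] **FACTORWISE DECAY ⟹ `secMajorant N A ≤ e^{−κL}·secMajorant N A′`**: the secant majorant is `(Σ_m N_m)` times the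
combinatorial majorant, so leaf-08's `actMajorant_le_exp_mul` transfers verbatim (`Σ_m N_m ≥ 0`). -/
theorem secMajorant_le_exp_mul {N A A' : P → J → ℝ} (hN : ∀ Z j, 0 ≤ N Z j) (hA : ∀ Z j, 0 ≤ A Z j) (hA' : ∀ Z j, 0 ≤ A' Z j)
    {s : P → ℝ} {κ : ℝ} (hκ : 0 ≤ κ) (hdec : ∀ Z j, A Z j ≤ A' Z j * Real.exp (-(κ * s Z))) {k : ℕ} {X : C.Dom} {L : ℝ}
    (hgeo : ∀ i, 𝒯.Rel k i X → L ≤ ∑ m, s (𝒯.poly i m)) (i : ι) :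
    secMajorant 𝒯 inc N A k X i ≤ Real.exp (-(κ * L)) * secMajorant 𝒯 inc N A' k X i := by
  unfold secMajorant
  rw [mul_left_comm]
  exact mul_le_mul_of_nonneg_left (actMajorant_le_exp_mul hA hA' hκ hdec hgeo i) (Finset.sum_nonneg fun m _ => hN _ _)

/-- [folklore] Summability of the secant majorant transfers from the stripped majorant `A′` to `A`. -/
theorem summable_secMajorant_of_decay {N A A' : P → J → ℝ} (hN : ∀ Z j, 0 ≤ N Z j) (hA : ∀ Z j, 0 ≤ A Z j)
    (hA' : ∀ Z j, 0 ≤ A' Z j) {s : P → ℝ} {κ : ℝ} (hκ : 0 ≤ κ) (hdec : ∀ Z j, A Z j ≤ A' Z j * Real.exp (-(κ * s Z))) {k : ℕ}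
    {X : C.Dom} {L : ℝ} (hgeo : ∀ i, 𝒯.Rel k i X → L ≤ ∑ m, s (𝒯.poly i m)) (hs : Summable (secMajorant 𝒯 inc N A' k X)) :
    Summable (secMajorant 𝒯 inc N A k X) :=
  Summable.of_nonneg_of_le (secMajorant_nonneg hN hA k X) (secMajorant_le_exp_mul hN hA hA' hκ hdec hgeo) (hs.mul_left _)

/-- [folklore] **THE FIRST-MOMENT BUDGET WITH RATE**: `Σ' secMajorant N A′ ≤ G₁ ⟹ Σ' secMajorant N A ≤ G₁·e^{−κL}`. -/
theorem tsum_secMajorant_le_of_decay {N A A' : P → J → ℝ} (hN : ∀ Z j, 0 ≤ N Z j) (hA : ∀ Z j, 0 ≤ A Z j)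
    (hA' : ∀ Z j, 0 ≤ A' Z j) {s : P → ℝ} {κ : ℝ} (hκ : 0 ≤ κ) (hdec : ∀ Z j, A Z j ≤ A' Z j * Real.exp (-(κ * s Z))) {k : ℕ}
    {X : C.Dom} {L : ℝ} (hgeo : ∀ i, 𝒯.Rel k i X → L ≤ ∑ m, s (𝒯.poly i m)) (hs : Summable (secMajorant 𝒯 inc N A' k X))
    {G₁ : ℝ} (hG : ∑' i, secMajorant 𝒯 inc N A' k X i ≤ G₁) :
    ∑' i, secMajorant 𝒯 inc N A k X i ≤ G₁ * Real.exp (-(κ * L)) :=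
  calc ∑' i, secMajorant 𝒯 inc N A k X i ≤ ∑' i, Real.exp (-(κ * L)) * secMajorant 𝒯 inc N A' k X i :=
        Summable.tsum_le_tsum (secMajorant_le_exp_mul hN hA hA' hκ hdec hgeo)
          (summable_secMajorant_of_decay hN hA hA' hκ hdec hgeo hs) (hs.mul_left _)
    _ = Real.exp (-(κ * L)) * ∑' i, secMajorant 𝒯 inc N A' k X i := tsum_mul_left
    _ ≤ Real.exp (-(κ * L)) * G₁ := mul_le_mul_of_nonneg_left hG (Real.exp_nonneg _)
    _ = G₁ * Real.exp (-(κ * L)) := mul_comm _ _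

variable {Op Hist Ω : Type*} [NormedAddCommGroup Op] [NormedSpace ℂ Op] [NormedAddCommGroup Hist] [NormedSpace ℂ Hist]
  [MeasurableSpace Ω] {act : P → J → Op → Hist → ℂ} {Dt : ActData P J Op Hist Ω}

/-- [folklore] **THE SECANT FACE AT RATE `κ`, ANY TERM INDEXING**: for a step model with `M.Out = out 𝒯 inc act`, leaf-08's structure
`ActExpLinearOn`, exponent bounds `ActExpNormBound … M.rHist N` (`N ≥ 0`), absolute activity majorants `ActAbsBound … A` (`A ≥ 0`)
which DECAY FACTORWISE against a stripped majorant `A′ ≥ 0` — `A k g U Z j ≤ A′ k g U Z j·e^{−κ s(Z)}`, `κ ≥ 0` ((2.38)-KIND with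
its decay factor displayed) — the geometric binder `d(X) ≤ Σ_m s(poly i m)` on the tuples localizing at each step-`k` domain
((2.27)-KIND), and FOR THE STRIPPED MAJORANT AT RATE 0 d3's convergence `Summable (actMajorant A′ k X)` and the first-moment budget
`Summable (secMajorant N A′ k X) ∧ Σ' ≤ G₁` ⟹ `HistSecant M K W κ (2G₁)`. -/
theorem histSecant_b13_of_act_decay {M : StepModel C Op Hist} (hM : ∀ k o h X, M.Out k o h X = out 𝒯 inc act k o h X)
    {K : ℕ → (ℕ → ℝ) → C.BgB → Set (Op × Hist)} {W : Set (ℕ → ℝ)} {N A A' : ℕ → (ℕ → ℝ) → C.BgB → P → J → ℝ}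
    {s : P → ℝ} {κ G₁ : ℝ} (hκ : 0 ≤ κ) (hexp : ActExpLinearOn 𝒯 act Dt K W) (hN : ActExpNormBound 𝒯 Dt K W M.rHist N)
    (habs : ActAbsBound 𝒯 Dt K W A) (hN0 : ∀ k g U Z j, 0 ≤ N k g U Z j) (hA0 : ∀ k g U Z j, 0 ≤ A k g U Z j)
    (hA0' : ∀ k g U Z j, 0 ≤ A' k g U Z j) (hdec : ∀ k g U Z j, A k g U Z j ≤ A' k g U Z j * Real.exp (-(κ * s Z)))
    (hgeo : ∀ (k : ℕ) (X : C.Dom), C.scale X = k → ∀ i, 𝒯.Rel k i X → C.d X ≤ ∑ m, s (𝒯.poly i m))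
    (hconv : ∀ k, ∀ g ∈ W, ∀ (U : C.BgB) (X : C.Dom), C.scale X = k → Summable (actMajorant 𝒯 inc (A' k g U) k X))
    (hmom : ∀ k, ∀ g ∈ W, ∀ (U : C.BgB) (X : C.Dom), C.scale X = k →
      Summable (secMajorant 𝒯 inc (N k g U) (A' k g U) k X) ∧ ∑' i, secMajorant 𝒯 inc (N k g U) (A' k g U) k X i ≤ G₁) :
    HistSecant M K W κ (2 * G₁) :=
  histSecant_b13_of_act hM hexp hN habs hN0
    (fun k g hg U X hX => summable_actMajorant_of_decay (hA0 k g U) (hA0' k g U) hκ (hdec k g U) (hgeo k X hX)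
      (hconv k g hg U X hX))
    fun k g hg U X hX =>
      ⟨summable_secMajorant_of_decay (hN0 k g U) (hA0 k g U) (hA0' k g U) hκ (hdec k g U) (hgeo k X hX) (hmom k g hg U X hX).1,
        tsum_secMajorant_le_of_decay (hN0 k g U) (hA0 k g U) (hA0' k g U) hκ (hdec k g U) (hgeo k X hX) (hmom k g hg U X hX).1
          (hmom k g hg U X hX).2⟩

/-- [folklore] **THE CAUCHY FACE AT RATE `κ`, ANY TERM INDEXING**: slack `BoxInClass`, a nonnegative activity norm majorant `A` at
the class points decaying factorwise against a stripped `A′ ≥ 0`, the geometric binder, and the per-domain budget `G` for `A′` at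
rate 0, plus the structure `ActExpLinearOn` ⟹ `HistFibreEnvelopeCl M W κ G` (`B13TermHistEnvelope.histFibreEnvelopeCl_b13_of_actBound`
with leaf-08's `summable_actMajorant_of_decay` ∕ `tsum_actMajorant_le_of_decay`). -/
theorem histFibreEnvelopeCl_b13_of_actBound_decay {M : StepModel C Op Hist}
    (hM : ∀ k o h X, M.Out k o h X = out 𝒯 inc act k o h X) {K : ℕ → (ℕ → ℝ) → C.BgB → Set (Op × Hist)} {W : Set (ℕ → ℝ)}
    {A A' : ℕ → (ℕ → ℝ) → C.BgB → P → J → ℝ} {s : P → ℝ} {κ G : ℝ} (hκ : 0 ≤ κ) (hbox : BoxInClass M K W)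
    (hA : ∀ k, ∀ g ∈ W, ∀ (U : C.BgB) (q : Op × Hist), q ∈ K k g U → ∀ X : C.Dom, C.scale X = k →
      ∀ i, 𝒯.Rel k i X → ∀ m, ‖act (𝒯.poly i m) (𝒯.lab i m) q.1 q.2‖ ≤ A k g U (𝒯.poly i m) (𝒯.lab i m))
    (hA0 : ∀ k g U Z j, 0 ≤ A k g U Z j) (hA0' : ∀ k g U Z j, 0 ≤ A' k g U Z j)
    (hdec : ∀ k g U Z j, A k g U Z j ≤ A' k g U Z j * Real.exp (-(κ * s Z)))
    (hgeo : ∀ (k : ℕ) (X : C.Dom), C.scale X = k → ∀ i, 𝒯.Rel k i X → C.d X ≤ ∑ m, s (𝒯.poly i m))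
    (hbud : ∀ k, ∀ g ∈ W, ∀ (U : C.BgB) (X : C.Dom), C.scale X = k →
      Summable (actMajorant 𝒯 inc (A' k g U) k X) ∧ ∑' i, actMajorant 𝒯 inc (A' k g U) k X i ≤ G)
    (hexp : ActExpLinearOn 𝒯 act Dt K W) : HistFibreEnvelopeCl M W κ G :=
  histFibreEnvelopeCl_b13_of_actBound 𝒯 inc act hM hbox hA (fun k g hg U X hX =>
    ⟨summable_actMajorant_of_decay (hA0 k g U) (hA0' k g U) hκ (hdec k g U) (hgeo k X hX) (hbud k g hg U X hX).1,
      tsum_actMajorant_le_of_decay (hA0 k g U) (hA0' k g U) hκ (hdec k g U) (hgeo k X hX) (hbud k g hg U X hX).1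
        (hbud k g hg U X hX).2⟩) hexp

end Generic

/-! ## §2 On the socket: the geometric binder IS the displayed (2.27); the stripped budgets from the anchored norm -/

section Socket

variable {C : Carriers} [DecidableEq C.Dom] {Cube : Type*} [DecidableEq Cube] {Bnd : Type*} [DecidableEq Bnd]
  {G : DomainGeometry C Cube} {D : InnerData C Bnd}
  {Op Hist Ω : Type*} [NormedAddCommGroup Op] [NormedSpace ℂ Op] [NormedAddCommGroup Hist] [NormedSpace ℂ Hist]
  [MeasurableSpace Ω] {act : C.Dom → InnerLabel C.Dom Bnd → Op → Hist → ℂ} {Dt : ActData C.Dom (InnerLabel C.Dom Bnd) Op Hist Ω}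

/-- [folklore] **THE SECANT FACE OF L04-hist WITH THE PRINTED KIND OF RATE, ON THE SOCKET** — the history-half twin of leaf-08's
`UrsellTermDecay.classBound_b13_of_actNormDecay`: for a step model with `M.Out = out (labelsIndexing G D) (touchInc G) act`,
leaf-08's STRUCTURE `ActExpLinearOn`; per-activity exponent bounds `ActExpNormBound … M.rHist N` with `0 ≤ N ≤ N̄`, `0 ≤ N̄`
((2.18)∕(2.20) KIND; displayed); ABSOLUTE activity majorants `ActAbsBound … 𝒜` with `𝒜 ≥ 0` decaying factorwise against a stripped
`𝒜′ ≥ 0`, `𝒜 ≤ 𝒜′·e^{−κ(d(Z)+c)}` (`κ, c ≥ 0`; (2.38)-KIND with its decay factor displayed); the displayed (2.27)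
`Ineq227 (G.level (scale X)) G.cubes C.d (G.cubes X) (C.d X) c` at every domain; and leaf-08's anchored exponential norm `Φ′` of
the stripped majorant on every step catalogue (footprint-local reach `ν`, `4νΦ′ < 1`; (2.38)+(1.26) KIND; displayed) ⟹
**`HistSecant M K W κ (2·(N̄·Φ′∕(1 − 4νΦ′)²))`** — no reach, no slack, no room, no analyticity, no series binder. -/
theorem histSecant_socket_of_actNormDecay {M : StepModel C Op Hist}
    (hM : ∀ k o h X, M.Out k o h X = out (labelsIndexing G D) (touchInc G) act k o h X)
    {K : ℕ → (ℕ → ℝ) → C.BgB → Set (Op × Hist)} {W : Set (ℕ → ℝ)}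
    {N 𝒜 𝒜' : ℕ → (ℕ → ℝ) → C.BgB → C.Dom → InnerLabel C.Dom Bnd → ℝ} {Nbar κ c ν Φ' : ℝ} (hκ : 0 ≤ κ) (hc : 0 ≤ c)
    (hexp : ActExpLinearOn (labelsIndexing G D) act Dt K W) (hN : ActExpNormBound (labelsIndexing G D) Dt K W M.rHist N)
    (hN0 : ∀ k g U Z ℓ, 0 ≤ N k g U Z ℓ) (hNle : ∀ k g U Z ℓ, N k g U Z ℓ ≤ Nbar) (hNbar : 0 ≤ Nbar)
    (habs : ActAbsBound (labelsIndexing G D) Dt K W 𝒜) (hA0 : ∀ k g U Z ℓ, 0 ≤ 𝒜 k g U Z ℓ)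
    (hA0' : ∀ k g U Z ℓ, 0 ≤ 𝒜' k g U Z ℓ) (hdec : ∀ k g U Z ℓ, 𝒜 k g U Z ℓ ≤ 𝒜' k g U Z ℓ * Real.exp (-(κ * (C.d Z + c))))
    (h227 : ∀ X : C.Dom, Ineq227 (G.level (C.scale X)) G.cubes C.d (G.cubes X) (C.d X) c)
    (reach : C.Dom → Finset Cube) (hloc : ∀ Z Z', touchInc G Z' Z → ∃ q ∈ reach Z, q ∈ G.cubes Z') (hν : 0 ≤ ν)
    (hreach : ∀ Z, ((reach Z).card : ℝ) ≤ ν * (G.cubes Z).card) (hΦ0 : 0 ≤ Φ') (hsmall : 4 * ν * Φ' < 1)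
    (hΦ : ∀ k, ∀ g ∈ W, ∀ (U : C.BgB) (q : Cube),
      ∑ Z ∈ G.level k, ind (q ∈ G.cubes Z) * polyWeight D (𝒜' k g U) k Z * Real.exp ((G.cubes Z).card) ≤ Φ') :
    HistSecant M K W κ (2 * (Nbar * (Φ' / (1 - 4 * ν * Φ') ^ 2))) := by
  refine histSecant_b13_of_act_decay (s := fun Z => C.d Z + c) hM hκ hexp hN habs hN0 hA0 hA0' hdec
    (fun _ X hX i hi => d_le_sum_polys_of_ineq227 G D hc (hX ▸ h227 X) i hi) (fun k g hg U X hX => ?_) fun k g hg U X hX => ?_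
  · exact B13ActMajorantLevels.summable_actMajorant_of_levelwise (hA0' k g U) hX
      (summable_levelMajorant_of_moment (hA0' k g U)
        (weighted_level_budget_of_actNorm reach (hA0' k g U) hloc hν hreach hΦ0 hsmall (hΦ k g hg U) hX).1)
  · have hw := weighted_level_budget_of_actNorm reach (hA0' k g U) hloc hν hreach hΦ0 hsmall (hΦ k g hg U) hX
    exact ⟨summable_secMajorant_of_levelwise (hN0 k g U) (hNle k g U) (hA0' k g U) hX hw.1,
      (tsum_secMajorant_le_of_levelwise (hN0 k g U) (hNle k g U) (hA0' k g U) hX hw.1).trans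
        (mul_le_mul_of_nonneg_left hw.2 hNbar)⟩

/-- [folklore] **THE CAUCHY FACE OF L04-hist WITH THE PRINTED KIND OF RATE, ON THE SOCKET**: slack `BoxInClass M K W` (displayed room),
a nonnegative activity norm majorant `𝒜` at the class points decaying factorwise against a stripped `𝒜′ ≥ 0`
(`𝒜 ≤ 𝒜′·e^{−κ(d(Z)+c)}`), the displayed (2.27) at every domain, leaf-08's anchored exponential norm `Φ′` of `𝒜′` (`4νΦ′ < 1`) and
the structure `ActExpLinearOn` ⟹ `HistFibreEnvelopeCl M W κ (Φ′∕(1 − 4νΦ′))`. -/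
theorem histFibreEnvelopeCl_socket_of_actNormDecay {M : StepModel C Op Hist}
    (hM : ∀ k o h X, M.Out k o h X = out (labelsIndexing G D) (touchInc G) act k o h X)
    {K : ℕ → (ℕ → ℝ) → C.BgB → Set (Op × Hist)} {W : Set (ℕ → ℝ)}
    {𝒜 𝒜' : ℕ → (ℕ → ℝ) → C.BgB → C.Dom → InnerLabel C.Dom Bnd → ℝ} {κ c ν Φ' : ℝ} (hκ : 0 ≤ κ) (hc : 0 ≤ c)
    (hbox : BoxInClass M K W)
    (hA : ∀ k, ∀ g ∈ W, ∀ (U : C.BgB) (q : Op × Hist), q ∈ K k g U → ∀ X : C.Dom, C.scale X = k →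
      ∀ i : TermIdx C.Dom Bnd, (labelsIndexing G D).Rel k i X →
        ∀ m, ‖act ((labelsIndexing G D).poly i m) ((labelsIndexing G D).lab i m) q.1 q.2‖ ≤
          𝒜 k g U ((labelsIndexing G D).poly i m) ((labelsIndexing G D).lab i m))
    (hA0 : ∀ k g U Z ℓ, 0 ≤ 𝒜 k g U Z ℓ) (hA0' : ∀ k g U Z ℓ, 0 ≤ 𝒜' k g U Z ℓ)
    (hdec : ∀ k g U Z ℓ, 𝒜 k g U Z ℓ ≤ 𝒜' k g U Z ℓ * Real.exp (-(κ * (C.d Z + c))))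
    (h227 : ∀ X : C.Dom, Ineq227 (G.level (C.scale X)) G.cubes C.d (G.cubes X) (C.d X) c)
    (reach : C.Dom → Finset Cube) (hloc : ∀ Z Z', touchInc G Z' Z → ∃ q ∈ reach Z, q ∈ G.cubes Z') (hν : 0 ≤ ν)
    (hreach : ∀ Z, ((reach Z).card : ℝ) ≤ ν * (G.cubes Z).card) (hΦ0 : 0 ≤ Φ') (hsmall : 4 * ν * Φ' < 1)
    (hΦ : ∀ k, ∀ g ∈ W, ∀ (U : C.BgB) (q : Cube),
      ∑ Z ∈ G.level k, ind (q ∈ G.cubes Z) * polyWeight D (𝒜' k g U) k Z * Real.exp ((G.cubes Z).card) ≤ Φ')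
    (hexp : ActExpLinearOn (labelsIndexing G D) act Dt K W) : HistFibreEnvelopeCl M W κ (Φ' / (1 - 4 * ν * Φ')) :=
  histFibreEnvelopeCl_b13_of_actBound_decay (s := fun Z => C.d Z + c) hM hκ hbox hA hA0 hA0' hdec
    (fun _ X hX i hi => d_le_sum_polys_of_ineq227 G D hc (hX ▸ h227 X) i hi)
    (fun k g hg U _ hX =>
      ⟨B13ActMajorantLevels.summable_actMajorant_of_levelwise (hA0' k g U) hX
          (UrsellTermBudget.summable_levelMajorant_socket G D (𝒜' k g U) reach (hA0' k g U) hloc hν hreach hΦ0 hsmall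
            (hΦ k g hg U) hX),
        B13ActMajorantLevels.tsum_actMajorant_le_of_levelwise (hA0' k g U) hX
          (UrsellTermBudget.summable_levelMajorant_socket G D (𝒜' k g U) reach (hA0' k g U) hloc hν hreach hΦ0 hsmall (hΦ k g hg U)
            hX)
          (UrsellTermBudget.tsum_levelMajorant_socket_le G D (𝒜' k g U) reach (hA0' k g U) hloc hν hreach hΦ0 hsmall
            (hΦ k g hg U) hX)⟩)
    hexp

end Socket

end Summit.QuantumFields.BalabanUV.T4Continuum.B13TermHistSecantDecay

end
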